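import Literature.NumberTheory.LFunctions.RodgersTaoNearbySumsProofs
import Literature.NumberTheory.LFunctions.RodgersTaoZeroDynamicsProofs
import Literature.NumberTheory.LFunctions.RodgersTaoTruncEnergyIntegrableProofs
import HarnessLib

/-!
# Rodgers–Tao 2020, Proposition 22 — the `ξ`-side principal value sum `Σ'_{i ≠ k} 1/(ξ_k − ξ_i)` and the negligibility of (sumjk-2) (P22 STAGE B-ξ)

RH-FREE, `t`-FREE CONTENT (2 defs = notation of the source, 0 named facts). In the proof of
**Proposition 22** of Rodgers–Tao, *The de Bruijn–Newman constant is non-negative*, Forum Math.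
Pi 8 (2020) e6 (FMP pp. 50–51; = arXiv:1801.05914v4 Prop. 7.7, v5 TeX l.1311–1330), after the
main term `X₁ + X₃` of (sumjk) has been isolated, the authors write: «A similar argument (replacing
`x_i` with `ξ_i` throughout) shows that the expression
`Σ_{j,k : j ∼_T k} ψ_T(j)ψ_T(k) (1/(ξ_k − ξ_j)) Σ'_{i : i ≠ k} 1/(ξ_k − ξ_i)` (sumjk-2)
is equal to `X'₁ + X'₃` plus negligible terms […] Thus, to complete the proof of the proposition, it
will suffice to show that the expression (sumjk-2) and the difference `X₃ − X'₃` are both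
negligible. The expression (sumjk-2) may be rearranged as
`Σ_k ψ_T(k) (Σ_{j : j ∼_T k} ψ_T(j)/(ξ_k − ξ_j)) (Σ'_{i : i ≠ k} 1/(ξ_k − ξ_i))`.
By (44), both inner sums are `Õ(1)` […] we see from (souse) that the factor
`Σ_{j : j ∼_T k} ψ_T(j)/(ξ_k − ξ_j)` is `o_{T→∞}(log T)`, and from (xikjd), (44), and the triangle
inequality we also see that `Σ'_{i : i ≠ k} 1/(ξ_k − ξ_i) = O(log T)`. Thus (sumjk-2) is negligible
as required.»

Here `Σ'` is the principal value summation of §1.2 (FMP p. 7: `Σ'_i = lim_{J→∞} Σ_{|i| ≤ J}`, all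
indices in `ℤ* = ℤ ∖ {0}`), `ξ_i` the classical locations (`classicalLocationZ`, odd in `i`),
`ψ_T` the weight (66) (`truncWeight`) and `j ∼_T k` the nearby relation (`Nearby`, `nearbyPairs`).
Everything in this module is a statement about `ξ`, `ψ_T` and `∼_T` ONLY — no zeros of `H_t`, no
time parameter, no hypothesis on `Λ`.

Contents (namespace `Literature.NumberTheory.LFunctions`, sub-namespace `RodgersTaoXiPV` for the
tools):

* `xiPVPartialSum k J`, `xiPVSum k` — the truncations `Σ_{i ∈ [−J,J]_{ℤ*}, i ≠ k} 1/(ξ_k − ξ_i)` and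
  their `lim_{J → ∞}` (a `limUnder`, exactly as the tree's `zeroVelocityPartialSum` /
  `zeroVelocitySum` for the zeros `x_i(t)` in (56));
* `RodgersTaoXiPV.xiPVPartialSum_eq_sum_range` — pairing `i = ±(m+1)`:
  `Σ_{[−J,J]_{ℤ*} ∖ {k}} = Σ_{m < J} (1/(ξ_k − ξ_{m+1}) + 1/(ξ_k + ξ_{m+1}))` (the `i = k` term being
  `1/0 = 0`);
* `RodgersTaoXiPV.summable_pairedTerm`, `RodgersTaoXiPV.xiPVSum_eq_tsum`,
  `tendsto_xiPVPartialSum`, `xiPVSum_neg` — the principal value CONVERGES for every `k ∈ ℤ*` (the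
  paired terms are `2ξ_k/(ξ_k² − ξ_{m+1}²) = O_k(log₊² m/m²)` beyond `2|k|`, by the elementary tail
  estimate `Σ_{i ≥ 2n} log₊² i/i² ≤ 258 log₊² n/n`), and `xiPVSum k` is its value; it is odd in `k`;
* `abs_xiPVSum_le` — **`|Σ'_{i ≠ k} 1/(ξ_k − ξ_i)| ≤ C log₊ k`** for all `k ∈ ℤ*`, an absolute `C`
  («`= O(log T)`» for `|k| ≤ T^{O(1)}`; the printed «(xikjd), (44) and the triangle inequality»,
  made explicit: the indices `i = k ± m`, `m ≤ c|k|`, are paired by (45)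
  (`exists_pair_inv_sub_classicalLocationZ_le`, each pair `O(1/|k|)`); the remaining `1 ≤ i < 2|k|`
  are `O(log₊ k)` in total by (44) (`exists_inv_abs_sub_classicalLocationZ_le`); the indices of the
  opposite sign contribute `≤ (2|k| − 1)/ξ_k = O(log₊ k)`; and the tail `|i| ≥ 2|k|`, paired as
  `2ξ_k/(ξ_k² − ξ_i²)`, is `O(ξ_k Σ_{i ≥ 2|k|} log₊² i/i²) = O(log₊ k)` by Lemma 8 (i), (ii));
* `sumjk2_negligible` (and `sumjk2_negligible'`, the same in the printed orientation `(j, k)`) —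
  **(sumjk-2) is negligible**: for every `ε > 0` there is `T₁` such that for all `T ≥ T₁` the family
  `(k, j) ↦ ψ_T(k)ψ_T(j) (1/(ξ_k − ξ_j)) Σ'_{i ≠ k} 1/(ξ_k − ξ_i)` on the nearby pairs is summable and
  its sum is at most `ε · T log³ T` in absolute value (the printed rearrangement
  `Σ_k ψ_T(k) S_k(T) P_k` with the tree's row sums `S_k(T) = Σ_{j ∼_T k} ψ_T(j)/(ξ_k − ξ_j)` of
  `RodgersTaoNearbySumsProofs` — display (souse), theorem `nearbyRow_weighted_tsum_le` — Fubini over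
  `ℤ × ℤ` with the majorant `ψ_T(k)(2+|k|)² · ψ_T(j)(2+|j|)`, and `abs_xiPVSum_le`).

Deviation from print: the paper bounds `Σ' 1/(ξ_k − ξ_i) = O(log T)` only for `T^{0.5} < |k| ≤ T^{1.5}`
and treats the other `k` by Lemma 21 (iii), (iv); here the bound `O(log₊ k)` holds for all `k`, and
the tree's form of (souse) (`|S_k(T)| ≤ C T^{−1/5} log₊ k` for `T ≤ k²`, `≤ K T^{1/5} log T` for
`k² < T`, packaged as `Σ_k ψ_T(k) log₊(ξ_k)|S_k(T)| = o(T log³ T)`) absorbs all ranges of `k` at once,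
so no appeal to Lemma 21 is needed for (sumjk-2).

LABEL: RH-FREE; bears_on N-C/N-P (COLUMN 3, de Bruijn–Newman side). WHAT THIS IS NOT: not
Proposition 22 (one `t`-free step of its STAGE B); no statement about the zeros of `H_t`; nothing
here bears on the truth of RH.

## References
* [RodgersTaoFMP2020] B. Rodgers, T. Tao, *The de Bruijn–Newman constant is non-negative*, Forum
  Math. Pi 8 (2020), e6 — Prop. 22, proof, pp. 50–51, displays (sumjk-2), (souse), (xikjd) of
  arXiv:1801.05914v4/v5; §1.2 p. 7 (principal value convention); Lemma 8 (43)–(45) p. 21.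
-/

noncomputable section

open Real Set Filter Topology

namespace Literature.NumberTheory.LFunctions

/-! ## The principal value sum of the classical locations -/

/-- The truncations `Σ_{i ∈ [−J, J]_{ℤ*}, i ≠ k} 1/(ξ_k − ξ_i)` of the principal value sum
`Σ'_{i : i ≠ k} 1/(ξ_k − ξ_i)` of the classical locations appearing in (sumjk-2) of the proof of
Proposition 22 («replacing `x_i` with `ξ_i` throughout»; principal value convention of §1.2,
`Σ'_i = lim_{J → ∞} Σ_{|i| ≤ J}`, indices in `ℤ*`). The `ξ`-analogue of `zeroVelocityPartialSum`.
[cite: RodgersTaoFMP2020, Prop. 22 p. 50 (sumjk-2); §1.2 p. 7] -/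
def xiPVPartialSum (k : ℤ) (J : ℕ) : ℝ :=
  ∑ i ∈ (zstarIcc (-(J : ℤ)) J).erase k, 1 / (classicalLocationZ k - classicalLocationZ i)

/-- The principal value sum `Σ'_{i : i ≠ k} 1/(ξ_k − ξ_i) = lim_{J → ∞} Σ_{i ∈ [−J,J]_{ℤ*}, i ≠ k} 1/(ξ_k − ξ_i)`
of (sumjk-2) (proof of Proposition 22, FMP p. 50), realised with `limUnder atTop` exactly as the
tree's `zeroVelocitySum`; `tendsto_xiPVPartialSum` shows that the limit exists for every `k ∈ ℤ*`,
so that `xiPVSum k` is its value (`xiPVSum_eq_of_tendsto`).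
[cite: RodgersTaoFMP2020, Prop. 22 p. 50 (sumjk-2); §1.2 p. 7] -/
def xiPVSum (k : ℤ) : ℝ :=
  limUnder atTop (xiPVPartialSum k)

/-- Unfolding lemma for `xiPVPartialSum`. [cite: RodgersTaoFMP2020, §1.2 p. 7] -/
theorem xiPVPartialSum_eq (k : ℤ) (J : ℕ) :
    xiPVPartialSum k J =
      ∑ i ∈ (zstarIcc (-(J : ℤ)) J).erase k, 1 / (classicalLocationZ k - classicalLocationZ i) := rfl

/-- If the truncations converge to `v`, then `xiPVSum k = v` (the `lim_{J → ∞}` of §1.2 is the value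
of `Σ'`). [cite: RodgersTaoFMP2020, §1.2 p. 7] -/
theorem xiPVSum_eq_of_tendsto {k : ℤ} {v : ℝ} (h : Tendsto (xiPVPartialSum k) atTop (𝓝 v)) :
    xiPVSum k = v :=
  h.limUnder_eq

namespace RodgersTaoXiPV

/-! ## Pairing `i = ±(m + 1)`: the truncations as sums over `m < J` -/

/-- `Σ_{i ∈ [−J,J]_{ℤ*}, i ≠ k} 1/(ξ_k − ξ_i) = Σ_{m < J} (1/(ξ_k − ξ_{m+1}) + 1/(ξ_k + ξ_{m+1}))`
for every `k ∈ ℤ` and `J` (the term `i = k`, if present, is `1/0 = 0`; `ξ_{−i} = −ξ_i`).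
[cite: RodgersTaoFMP2020, §1.2 p. 7 (principal value convention)] -/
theorem xiPVPartialSum_eq_sum_range (k : ℤ) (J : ℕ) :
    xiPVPartialSum k J = ∑ m ∈ Finset.range J,
      (1 / (classicalLocationZ k - classicalLocationZ ((m : ℤ) + 1)) +
        1 / (classicalLocationZ k + classicalLocationZ ((m : ℤ) + 1))) := by
  have hself : (1 : ℝ) / (classicalLocationZ k - classicalLocationZ k) = 0 := by simp
  rw [xiPVPartialSum_eq,
    Finset.sum_erase (f := fun i ↦ 1 / (classicalLocationZ k - classicalLocationZ i)) _ hself,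
    sum_zstarIcc_symm (fun i ↦ 1 / (classicalLocationZ k - classicalLocationZ i))]
  refine Finset.sum_congr rfl fun m _ ↦ ?_
  rw [classicalLocationZ_neg, sub_neg_eq_add]

/-- The paired term in closed form: `1/(ξ_k − y) + 1/(ξ_k + y) = 2ξ_k/(ξ_k² − y²)` whenever
`y ≠ ±ξ_k`. [folklore] -/
private theorem inv_sub_add_inv_add {x y : ℝ} (h1 : x - y ≠ 0) (h2 : x + y ≠ 0) :
    1 / (x - y) + 1 / (x + y) = 2 * x / (x ^ 2 - y ^ 2) := by
  have h3 : x ^ 2 - y ^ 2 ≠ 0 := by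
    have : x ^ 2 - y ^ 2 = (x - y) * (x + y) := by ring
    rw [this]; exact mul_ne_zero h1 h2
  field_simp
  ring

/-- For `m + 1 ≠ |k|` the paired term is `2ξ_k/(ξ_k² − ξ_{m+1}²)`.
[cite: RodgersTaoFMP2020, §1.2 p. 7; §3 p. 21 (ξ_{−j} = −ξ_j)] -/
theorem pairedTerm_eq {k : ℤ} {m : ℕ} (hm : (m : ℤ) + 1 ≠ k) (hm' : (m : ℤ) + 1 ≠ -k) :
    1 / (classicalLocationZ k - classicalLocationZ ((m : ℤ) + 1)) +
        1 / (classicalLocationZ k + classicalLocationZ ((m : ℤ) + 1)) =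
      2 * classicalLocationZ k / (classicalLocationZ k ^ 2 - classicalLocationZ ((m : ℤ) + 1) ^ 2) := by
  have h1 : classicalLocationZ k - classicalLocationZ ((m : ℤ) + 1) ≠ 0 :=
    sub_ne_zero.2 fun h ↦ hm (strictMono_classicalLocationZ.injective h).symm
  have h2 : classicalLocationZ k + classicalLocationZ ((m : ℤ) + 1) ≠ 0 := by
    rw [← sub_neg_eq_add, ← classicalLocationZ_neg]
    exact sub_ne_zero.2 fun h ↦ hm' (by
      have := (strictMono_classicalLocationZ.injective h).symm
      omega)
  exact inv_sub_add_inv_add h1 h2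

/-- Oddness of the truncations: `Σ_{[−J,J]_{ℤ*} ∖ {−k}} 1/(ξ_{−k} − ξ_i) = −Σ_{[−J,J]_{ℤ*} ∖ {k}} 1/(ξ_k − ξ_i)`.
[cite: RodgersTaoFMP2020, §3 p. 21 (ξ_{−j} = −ξ_j)] -/
theorem xiPVPartialSum_neg (k : ℤ) (J : ℕ) : xiPVPartialSum (-k) J = -xiPVPartialSum k J := by
  rw [xiPVPartialSum_eq_sum_range, xiPVPartialSum_eq_sum_range, ← Finset.sum_neg_distrib]
  refine Finset.sum_congr rfl fun m _ ↦ ?_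
  rw [classicalLocationZ_neg]
  have e1 : -classicalLocationZ k - classicalLocationZ ((m : ℤ) + 1) =
      -(classicalLocationZ k + classicalLocationZ ((m : ℤ) + 1)) := by ring
  have e2 : -classicalLocationZ k + classicalLocationZ ((m : ℤ) + 1) =
      -(classicalLocationZ k - classicalLocationZ ((m : ℤ) + 1)) := by ring
  rw [e1, e2, div_neg, div_neg]
  ring


/-! ## Elementary tail estimates: `Σ_{i ≥ 2n} log₊² i / i² ≪ log₊² n / n` -/

/-- `log y ≤ 4 √(√y)` for `y > 0` (`log y = 4 log y^{1/4} ≤ 4 (y^{1/4} − 1)`). [folklore] -/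
private theorem log_le_four_mul_sqrt_sqrt {y : ℝ} (hy : 0 < y) :
    Real.log y ≤ 4 * Real.sqrt (Real.sqrt y) := by
  have h1 : Real.log y = 4 * Real.log (Real.sqrt (Real.sqrt y)) := by
    rw [Real.log_sqrt (Real.sqrt_nonneg y), Real.log_sqrt hy.le]; ring
  have h2 : 0 < Real.sqrt (Real.sqrt y) := Real.sqrt_pos.2 (Real.sqrt_pos.2 hy)
  have h3 := Real.log_le_sub_one_of_pos h2
  rw [h1]; linarith

/-- For `1 ≤ n ≤ i`: `log₊² i ≤ 2 log₊² n + 32 √(i/n)` (`log₊ i ≤ log₊ n + log(i/n)` and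
`log(i/n) ≤ 4 (i/n)^{1/4}`). [folklore] -/
private theorem logPlus_sq_le_of_le {n i : ℝ} (hn : 1 ≤ n) (hni : n ≤ i) :
    logPlus i ^ 2 ≤ 2 * logPlus n ^ 2 + 32 * Real.sqrt (i / n) := by
  have hn0 : 0 < n := by linarith
  have hi0 : 0 < i := by linarith
  have hq : 1 ≤ i / n := by rw [le_div_iff₀ hn0]; linarith
  have h1 : logPlus i ≤ logPlus n + Real.log (i / n) := by
    rw [logPlus_eq, logPlus_eq, abs_of_pos hi0, abs_of_pos hn0,
      ← Real.log_mul (by linarith) (by positivity)]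
    refine Real.log_le_log (by linarith) ?_
    rw [mul_div_assoc', le_div_iff₀ hn0]
    nlinarith
  have h2 : Real.log (i / n) ≤ 4 * Real.sqrt (Real.sqrt (i / n)) :=
    log_le_four_mul_sqrt_sqrt (by positivity)
  have h3 : 0 ≤ Real.log (i / n) := Real.log_nonneg hq
  have h5 : Real.sqrt (Real.sqrt (i / n)) ^ 2 = Real.sqrt (i / n) :=
    Real.sq_sqrt (Real.sqrt_nonneg _)
  have h6 : logPlus i ^ 2 ≤ (logPlus n + Real.log (i / n)) ^ 2 :=
    pow_le_pow_left₀ (logPlus_nonneg i) h1 2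
  have h7 : Real.log (i / n) ^ 2 ≤ 16 * Real.sqrt (i / n) := by
    have := pow_le_pow_left₀ h3 h2 2
    rw [mul_pow, h5] at this
    linarith
  nlinarith [sq_nonneg (logPlus n - Real.log (i / n))]

/-- `Σ_{i ∈ S} 1/i² ≤ 1/n` for a finite set `S` of integers `≥ 2n`, `n ≥ 1`. [folklore] -/
private theorem sum_inv_sq_le {n : ℕ} (hn : 1 ≤ n) {S : Finset ℕ} (hS : ∀ i ∈ S, 2 * n ≤ i) :
    ∑ i ∈ S, 1 / (i : ℝ) ^ 2 ≤ 1 / (n : ℝ) := by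
  obtain ⟨N, hN⟩ := Finset.exists_nat_subset_range S
  have hsub : S ⊆ Finset.Ioo (2 * n - 1) N := by
    intro i hi
    have h1 := hS i hi
    have h2 := Finset.mem_range.1 (hN hi)
    rw [Finset.mem_Ioo]; omega
  have hn0 : (0 : ℝ) < n := by exact_mod_cast hn
  calc ∑ i ∈ S, 1 / (i : ℝ) ^ 2 ≤ ∑ i ∈ Finset.Ioo (2 * n - 1) N, 1 / (i : ℝ) ^ 2 :=
        Finset.sum_le_sum_of_subset_of_nonneg hsub fun i _ _ ↦ by positivity
    _ = ∑ i ∈ Finset.Ioo (2 * n - 1) N, ((i : ℝ) ^ 2)⁻¹ := by simp_rw [one_div]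
    _ ≤ 2 / ((2 * n - 1 : ℕ) + 1 : ℝ) := sum_Ioo_inv_sq_le _ _
    _ = 1 / (n : ℝ) := by
        have : ((2 * n - 1 : ℕ) : ℝ) + 1 = 2 * n := by
          have h : 2 * n - 1 + 1 = 2 * n := by omega
          exact_mod_cast h
        rw [this]; field_simp

/-- `√i/i² ≤ 2 (1/√(i−1) − 1/√i)` for an integer `i ≥ 2`. [folklore] -/
private theorem sqrt_div_sq_le_telescope {i : ℕ} (hi : 2 ≤ i) :
    Real.sqrt i / (i : ℝ) ^ 2 ≤ 2 * (1 / Real.sqrt ((i - 1 : ℕ) : ℝ) - 1 / Real.sqrt i) := by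
  have hi2 : (2 : ℝ) ≤ i := by exact_mod_cast hi
  have hcast : ((i - 1 : ℕ) : ℝ) = (i : ℝ) - 1 := by
    rw [Nat.cast_sub (by omega)]; simp
  rw [hcast]
  set a := Real.sqrt ((i : ℝ) - 1) with ha
  set b := Real.sqrt (i : ℝ) with hb
  have ha2 : a ^ 2 = (i : ℝ) - 1 := Real.sq_sqrt (by linarith)
  have hb2 : b ^ 2 = (i : ℝ) := Real.sq_sqrt (by linarith)
  have ha0 : 0 < a := Real.sqrt_pos.2 (by linarith)
  have hb0 : 0 < b := Real.sqrt_pos.2 (by linarith)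
  have hab : a ≤ b := Real.sqrt_le_sqrt (by linarith)
  have hi4 : (i : ℝ) ^ 2 = b ^ 4 := by rw [← hb2]; ring
  -- (b - a)(b + a) = 1, so b - a = 1/(a + b)
  have h1 : (b - a) * (b + a) = 1 := by nlinarith [ha2, hb2]
  have h2 : b - a = 1 / (b + a) := by
    rw [eq_div_iff (by positivity)]; exact h1
  rw [hi4, div_sub_div _ _ ha0.ne' hb0.ne', one_mul, mul_one, div_le_iff₀ (by positivity)]
  have key : 2 * ((b - a) / (a * b)) * b ^ 4 = 2 * b ^ 3 / (a * (a + b)) := by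
    rw [h2]; field_simp; ring
  rw [key, le_div_iff₀ (by positivity)]
  have h3 : a * (a + b) ≤ 2 * b ^ 2 := by nlinarith [hab, ha0.le, hb0.le]
  calc b * (a * (a + b)) ≤ b * (2 * b ^ 2) := mul_le_mul_of_nonneg_left h3 hb0.le
    _ = 2 * b ^ 3 := by ring

/-- `Σ_{i ∈ S} √i/i² ≤ 2/√n` for a finite set `S` of integers `≥ 2n`, `n ≥ 1` (telescoping).
[folklore] -/
private theorem sum_sqrt_div_sq_le {n : ℕ} (hn : 1 ≤ n) {S : Finset ℕ} (hS : ∀ i ∈ S, 2 * n ≤ i) :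
    ∑ i ∈ S, Real.sqrt i / (i : ℝ) ^ 2 ≤ 2 / Real.sqrt n := by
  obtain ⟨N, hN⟩ := Finset.exists_nat_subset_range S
  set g : ℕ → ℝ := fun i ↦ 1 / Real.sqrt i with hg
  have hg0 : ∀ i, 0 ≤ g i := fun i ↦ by positivity
  have hsub : S ⊆ Finset.Ico (2 * n) (2 * n + N) := by
    intro i hi
    have h1 := hS i hi
    have h2 := Finset.mem_range.1 (hN hi)
    rw [Finset.mem_Ico]; omega
  have hterm : ∀ i ∈ Finset.Ico (2 * n) (2 * n + N),
      Real.sqrt i / (i : ℝ) ^ 2 ≤ 2 * (g (i - 1) - g i) := by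
    intro i hi
    rw [Finset.mem_Ico] at hi
    exact sqrt_div_sq_le_telescope (by omega)
  have htele : ∑ i ∈ Finset.Ico (2 * n) (2 * n + N), 2 * (g (i - 1) - g i) =
      2 * (g (2 * n - 1) - g (2 * n - 1 + N)) := by
    rw [← Finset.mul_sum, Finset.sum_Ico_eq_sum_range]
    congr 1
    have : ∀ j ∈ Finset.range (2 * n + N - 2 * n),
        g (2 * n + j - 1) - g (2 * n + j) = g (2 * n - 1 + j) - g (2 * n - 1 + (j + 1)) := by
      intro j _
      have e1 : 2 * n + j - 1 = 2 * n - 1 + j := by omega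
      have e2 : 2 * n + j = 2 * n - 1 + (j + 1) := by omega
      rw [e1, ← e2]
    rw [Finset.sum_congr rfl this, Finset.sum_range_sub' (fun j ↦ g (2 * n - 1 + j)), add_zero,
      show 2 * n + N - 2 * n = N by omega]
  have hn1 : (1 : ℝ) ≤ n := by exact_mod_cast hn
  calc ∑ i ∈ S, Real.sqrt i / (i : ℝ) ^ 2
      ≤ ∑ i ∈ Finset.Ico (2 * n) (2 * n + N), Real.sqrt i / (i : ℝ) ^ 2 :=
        Finset.sum_le_sum_of_subset_of_nonneg hsub fun i _ _ ↦ by positivity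
    _ ≤ ∑ i ∈ Finset.Ico (2 * n) (2 * n + N), 2 * (g (i - 1) - g i) := Finset.sum_le_sum hterm
    _ = 2 * (g (2 * n - 1) - g (2 * n - 1 + N)) := htele
    _ ≤ 2 * g (2 * n - 1) := by linarith [hg0 (2 * n - 1 + N)]
    _ ≤ 2 / Real.sqrt n := by
        rw [hg, mul_one_div]
        refine div_le_div_of_nonneg_left (by norm_num) (Real.sqrt_pos.2 (by linarith)) ?_
        refine Real.sqrt_le_sqrt ?_
        have : n ≤ 2 * n - 1 := by omega
        exact_mod_cast this

/-- **Tail of `Σ log₊² i/i²`**: `Σ_{i ∈ S} log₊² i/i² ≤ 258 · log₊² n/n` for every finite set `S` of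
integers `≥ 2n`, `n ≥ 1`. [folklore] -/
private theorem sum_logPlus_sq_div_sq_tail_le {n : ℕ} (hn : 1 ≤ n) {S : Finset ℕ}
    (hS : ∀ i ∈ S, 2 * n ≤ i) :
    ∑ i ∈ S, logPlus i ^ 2 / (i : ℝ) ^ 2 ≤ 258 * (logPlus n ^ 2 / n) := by
  have hn1 : (1 : ℝ) ≤ n := by exact_mod_cast hn
  have hn0 : (0 : ℝ) < n := by linarith
  have hsq0 : 0 < Real.sqrt n := Real.sqrt_pos.2 hn0
  -- termwise
  have hterm : ∀ i ∈ S, logPlus i ^ 2 / (i : ℝ) ^ 2 ≤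
      2 * logPlus n ^ 2 * (1 / (i : ℝ) ^ 2) + 32 / Real.sqrt n * (Real.sqrt i / (i : ℝ) ^ 2) := by
    intro i hi
    have h2n := hS i hi
    have hni : (n : ℝ) ≤ i := by exact_mod_cast (show n ≤ i by omega)
    have hi0 : (0 : ℝ) < i := by linarith
    have h1 := logPlus_sq_le_of_le hn1 hni
    rw [Real.sqrt_div' _ hn0.le] at h1
    have e : 2 * logPlus n ^ 2 * (1 / (i : ℝ) ^ 2) + 32 / Real.sqrt n * (Real.sqrt i / (i : ℝ) ^ 2) =
        (2 * logPlus n ^ 2 + 32 * (Real.sqrt i / Real.sqrt n)) / (i : ℝ) ^ 2 := by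
      field_simp
    rw [e]
    exact div_le_div_of_nonneg_right h1 (by positivity)
  have h1 := sum_inv_sq_le hn hS
  have h2 := sum_sqrt_div_sq_le hn hS
  have hlog2 : (1 : ℝ) / 2 ≤ Real.log 2 := by
    have := Real.log_two_gt_d9; linarith
  have hL : Real.log 2 ≤ logPlus (n : ℝ) := log_two_le_logPlus _
  have hL2 : (1 : ℝ) ≤ 4 * logPlus (n : ℝ) ^ 2 := by nlinarith
  calc ∑ i ∈ S, logPlus i ^ 2 / (i : ℝ) ^ 2
      ≤ ∑ i ∈ S, (2 * logPlus n ^ 2 * (1 / (i : ℝ) ^ 2) +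
          32 / Real.sqrt n * (Real.sqrt i / (i : ℝ) ^ 2)) := Finset.sum_le_sum hterm
    _ = 2 * logPlus n ^ 2 * ∑ i ∈ S, 1 / (i : ℝ) ^ 2 +
          32 / Real.sqrt n * ∑ i ∈ S, Real.sqrt i / (i : ℝ) ^ 2 := by
        rw [Finset.sum_add_distrib, Finset.mul_sum, Finset.mul_sum]
    _ ≤ 2 * logPlus n ^ 2 * (1 / n) + 32 / Real.sqrt n * (2 / Real.sqrt n) := by
        gcongr
    _ = (2 * logPlus n ^ 2 + 64) / n := by
        have hs2 : Real.sqrt n ^ 2 = n := Real.sq_sqrt hn0.le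
        rw [mul_one_div, div_mul_div_comm, ← pow_two, hs2]
        ring
    _ ≤ (2 * logPlus n ^ 2 + 256 * logPlus n ^ 2) / n := by
        gcongr; linarith
    _ = 258 * (logPlus n ^ 2 / n) := by ring


/-! ## Quantitative bounds on the classical locations (Lemma 8 (i), (ii)) -/

/-- Multiplicative separation: there is `δ > 0` with `δ ξ_i² ≤ ξ_i² − ξ_n²` whenever `1 ≤ n` and
`2n ≤ i` (from (44) `ξ_i − ξ_n ≫ (i − n)/log₊(ξ_n + ξ_i)` and (43) `ξ_i ≍ i/log₊ i`,
`log₊ ξ_i ≍ log₊ i`). [cite: RodgersTaoFMP2020, Lemma 8 (i)–(ii) (43)–(44) p. 21] -/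
theorem exists_sq_sub_sq_ge :
    ∃ δ : ℝ, 0 < δ ∧ ∀ n i : ℤ, 1 ≤ n → 2 * n ≤ i →
      δ * classicalLocationZ i ^ 2 ≤ classicalLocationZ i ^ 2 - classicalLocationZ n ^ 2 := by
  obtain ⟨c₂, hc₂, h44⟩ := lemma8_ii_pos
  obtain ⟨c₁, C₁, hc₁, hc₁C₁, h8⟩ := lemma8_i_order
  have hC₁ : 0 < C₁ := hc₁.trans_le hc₁C₁
  refine ⟨c₂ / (4 * C₁ ^ 2), by positivity, fun n i hn hni ↦ ?_⟩
  set δ : ℝ := c₂ / (4 * C₁ ^ 2) with hδ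
  have hδ0 : 0 < δ := by positivity
  have hn0 : (0 : ℤ) < n := by omega
  have hi0 : (0 : ℤ) < i := by omega
  have hnR : (1 : ℝ) ≤ n := by exact_mod_cast hn
  have hiR : (1 : ℝ) ≤ i := by exact_mod_cast (show (1 : ℤ) ≤ i by omega)
  have hniR : 2 * (n : ℝ) ≤ i := by exact_mod_cast hni
  rw [classicalLocationZ_of_pos hn0, classicalLocationZ_of_pos hi0]
  set ξn := classicalLocation (n : ℝ) with hξn
  set ξi := classicalLocation (i : ℝ) with hξi
  have hξn0 : 0 < ξn := classicalLocation_pos (by linarith)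
  have hξi0 : 0 < ξi := classicalLocation_pos (by linarith)
  have hξle : ξn ≤ ξi := (classicalLocation_le_iff (by linarith) (by linarith)).2 (by linarith)
  have hgap := h44 n i hn (by omega)
  obtain ⟨-, hup_i, -, hlog_up_i⟩ := h8 (i : ℝ) hiR
  have hL0 : 0 < logPlus (ξn + ξi) := logPlus_pos _
  have hlogi0 : 0 < logPlus (i : ℝ) := logPlus_pos _
  have hL : logPlus (ξn + ξi) ≤ 2 * C₁ * logPlus (i : ℝ) :=
    calc logPlus (ξn + ξi) ≤ logPlus (2 * ξi) :=
          logPlus_mono (by rw [abs_of_pos (by positivity), abs_of_pos (by positivity)]; linarith)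
      _ ≤ 2 * logPlus ξi := logPlus_two_mul_le hξi0.le
      _ ≤ 2 * (C₁ * logPlus (i : ℝ)) := by gcongr
      _ = 2 * C₁ * logPlus (i : ℝ) := by ring
  have step1 : c₂ * (((i : ℝ) - n) / (2 * C₁ * logPlus (i : ℝ))) ≤ ξi - ξn := by
    refine le_trans (mul_le_mul_of_nonneg_left ?_ hc₂.le) hgap
    exact div_le_div_of_nonneg_left (by linarith) hL0 hL
  have hsep : δ * ξi ≤ ξi - ξn := by
    calc δ * ξi ≤ δ * (C₁ * ((i : ℝ) / logPlus (i : ℝ))) :=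
          mul_le_mul_of_nonneg_left hup_i hδ0.le
      _ = c₂ * (((i : ℝ) / 2) / (2 * C₁ * logPlus (i : ℝ))) := by
          rw [hδ]; field_simp; ring
      _ ≤ c₂ * (((i : ℝ) - n) / (2 * C₁ * logPlus (i : ℝ))) := by
          gcongr; linarith
      _ ≤ ξi - ξn := step1
  have hδ1 : δ ≤ 1 := by
    by_contra h
    push Not at h
    have : ξi < δ * ξi := by nlinarith
    linarith
  have hξn_le' : ξn ≤ (1 - δ) * ξi := by linarith
  have hsq : ξn ^ 2 ≤ ((1 - δ) * ξi) ^ 2 := pow_le_pow_left₀ hξn0.le hξn_le' 2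
  nlinarith [mul_nonneg (mul_nonneg hδ0.le (sub_nonneg.2 hδ1)) (sq_nonneg ξi)]

/-- **The paired tail terms**: `|2ξ_n/(ξ_n² − ξ_i²)| ≤ K ξ_n log₊² i/i²` for `1 ≤ n`, `2n ≤ i`, an
absolute `K` (`ξ_i² − ξ_n² ≥ δ ξ_i²` and `ξ_i ≥ c i/log₊ i`).
[cite: RodgersTaoFMP2020, Lemma 8 (i)–(ii) (43)–(44) p. 21] -/
theorem exists_pairedTail_le :
    ∃ K : ℝ, 0 ≤ K ∧ ∀ n i : ℤ, 1 ≤ n → 2 * n ≤ i →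
      |2 * classicalLocationZ n / (classicalLocationZ n ^ 2 - classicalLocationZ i ^ 2)| ≤
        K * classicalLocationZ n * (logPlus (i : ℝ) ^ 2 / (i : ℝ) ^ 2) := by
  obtain ⟨δ, hδ, hsep⟩ := exists_sq_sub_sq_ge
  obtain ⟨c₁, C₁, hc₁, -, h8⟩ := lemma8_i_order
  refine ⟨2 / (δ * c₁ ^ 2), by positivity, fun n i hn hni ↦ ?_⟩
  have hn0 : (0 : ℤ) < n := by omega
  have hi0 : (0 : ℤ) < i := by omega
  have hiR : (1 : ℝ) ≤ i := by exact_mod_cast (show (1 : ℤ) ≤ i by omega)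
  have hiR0 : (0 : ℝ) < i := by linarith
  have hden := hsep n i hn hni
  have hξn0 : 0 < classicalLocationZ n := classicalLocationZ_pos hn0
  have hξi0 : 0 < classicalLocationZ i := classicalLocationZ_pos hi0
  have hden0 : 0 < classicalLocationZ i ^ 2 - classicalLocationZ n ^ 2 :=
    lt_of_lt_of_le (by positivity) hden
  have hlo : c₁ * ((i : ℝ) / logPlus (i : ℝ)) ≤ classicalLocationZ i := by
    rw [classicalLocationZ_of_pos hi0]; exact (h8 (i : ℝ) hiR).1
  have hlogi0 : 0 < logPlus (i : ℝ) := logPlus_pos _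
  have hlo0 : 0 < c₁ * ((i : ℝ) / logPlus (i : ℝ)) := by positivity
  rw [show classicalLocationZ n ^ 2 - classicalLocationZ i ^ 2 =
      -(classicalLocationZ i ^ 2 - classicalLocationZ n ^ 2) by ring, div_neg, abs_neg,
    abs_of_pos (div_pos (by positivity) hden0)]
  calc 2 * classicalLocationZ n / (classicalLocationZ i ^ 2 - classicalLocationZ n ^ 2)
      ≤ 2 * classicalLocationZ n / (δ * classicalLocationZ i ^ 2) :=
        div_le_div_of_nonneg_left (by positivity) (by positivity) hden
    _ ≤ 2 * classicalLocationZ n / (δ * (c₁ * ((i : ℝ) / logPlus (i : ℝ))) ^ 2) := by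
        apply div_le_div_of_nonneg_left (by positivity) (by positivity)
        gcongr
    _ = 2 / (δ * c₁ ^ 2) * classicalLocationZ n * (logPlus (i : ℝ) ^ 2 / (i : ℝ) ^ 2) := by
        field_simp

/-- The paired terms of the principal value sum beyond `2n`, summed over any finite set of indices,
are `O(log₊ n)`: `Σ_{m ∈ S} |1/(ξ_n − ξ_{m+1}) + 1/(ξ_n + ξ_{m+1})| ≤ K' log₊ n` whenever
`m + 1 ≥ 2n` on `S` (`n ≥ 1`). [cite: RodgersTaoFMP2020, Prop. 22 p. 51 («Σ' 1/(ξ_k − ξ_i) = O(log T)»)] -/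
theorem exists_sum_pairedTail_le :
    ∃ K : ℝ, 0 ≤ K ∧ ∀ n : ℕ, 1 ≤ n → ∀ S : Finset ℕ, (∀ m ∈ S, 2 * n ≤ m + 1) →
      ∑ m ∈ S, |1 / (classicalLocationZ n - classicalLocationZ ((m : ℤ) + 1)) +
          1 / (classicalLocationZ n + classicalLocationZ ((m : ℤ) + 1))| ≤ K * logPlus (n : ℝ) := by
  obtain ⟨K, hK, htail⟩ := exists_pairedTail_le
  obtain ⟨c₁, C₁, hc₁, hc₁C₁, h8⟩ := lemma8_i_order
  have hC₁ : 0 < C₁ := hc₁.trans_le hc₁C₁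
  refine ⟨K * C₁ * 258, by positivity, fun n hn S hS ↦ ?_⟩
  have hn1 : (1 : ℝ) ≤ n := by exact_mod_cast hn
  have hn0 : (0 : ℝ) < n := by linarith
  have hnZ : (1 : ℤ) ≤ (n : ℤ) := by exact_mod_cast hn
  have hnZ0 : (0 : ℤ) < (n : ℤ) := by omega
  have hξn0 : 0 < classicalLocationZ (n : ℤ) := classicalLocationZ_pos hnZ0
  have hξn_up : classicalLocationZ (n : ℤ) ≤ C₁ * ((n : ℝ) / logPlus (n : ℝ)) := by
    rw [classicalLocationZ_of_pos hnZ0]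
    have := (h8 (n : ℝ) (by exact_mod_cast hn)).2.1
    exact_mod_cast this
  have hlogn0 : 0 < logPlus (n : ℝ) := logPlus_pos _
  -- termwise: closed form + tail bound
  have hterm : ∀ m ∈ S,
      |1 / (classicalLocationZ n - classicalLocationZ ((m : ℤ) + 1)) +
          1 / (classicalLocationZ n + classicalLocationZ ((m : ℤ) + 1))| ≤
        K * classicalLocationZ (n : ℤ) *
          (logPlus (((m + 1 : ℕ) : ℝ)) ^ 2 / (((m + 1 : ℕ) : ℝ)) ^ 2) := by
    intro m hm
    have h2 := hS m hm
    have hm1 : (m : ℤ) + 1 ≠ (n : ℤ) := by omega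
    have hm2 : (m : ℤ) + 1 ≠ -(n : ℤ) := by omega
    rw [pairedTerm_eq hm1 hm2]
    have h3 := htail (n : ℤ) ((m : ℤ) + 1) hnZ (by omega)
    have e : (((m : ℤ) + 1 : ℤ) : ℝ) = ((m + 1 : ℕ) : ℝ) := by push_cast; ring
    rw [e] at h3
    exact h3
  have hS' : ∀ i ∈ S.map ⟨Nat.succ, Nat.succ_injective⟩, 2 * n ≤ i := by
    intro i hi
    rw [Finset.mem_map] at hi
    obtain ⟨m, hm, rfl⟩ := hi
    exact hS m hm
  have hsum := sum_logPlus_sq_div_sq_tail_le hn hS'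
  rw [Finset.sum_map] at hsum
  calc ∑ m ∈ S, |1 / (classicalLocationZ n - classicalLocationZ ((m : ℤ) + 1)) +
          1 / (classicalLocationZ n + classicalLocationZ ((m : ℤ) + 1))|
      ≤ ∑ m ∈ S, K * classicalLocationZ (n : ℤ) *
          (logPlus (((m + 1 : ℕ) : ℝ)) ^ 2 / (((m + 1 : ℕ) : ℝ)) ^ 2) := Finset.sum_le_sum hterm
    _ = K * classicalLocationZ (n : ℤ) *
          ∑ m ∈ S, logPlus (((m + 1 : ℕ) : ℝ)) ^ 2 / (((m + 1 : ℕ) : ℝ)) ^ 2 := by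
        rw [Finset.mul_sum]
    _ ≤ K * classicalLocationZ (n : ℤ) * (258 * (logPlus (n : ℝ) ^ 2 / n)) := by
        exact mul_le_mul_of_nonneg_left hsum (by positivity)
    _ ≤ K * (C₁ * ((n : ℝ) / logPlus (n : ℝ))) * (258 * (logPlus (n : ℝ) ^ 2 / n)) := by
        gcongr
    _ = K * C₁ * 258 * logPlus (n : ℝ) := by
        field_simp

/-! ## Convergence of the principal value sum -/

/-- For `n ≥ 1` the paired terms `1/(ξ_n − ξ_{m+1}) + 1/(ξ_n + ξ_{m+1})` are summable in `m`
(beyond `2n` they are `O_n(log₊² m/m²)`). [cite: RodgersTaoFMP2020, §1.2 p. 7; Lemma 8 p. 21] -/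
theorem summable_pairedTerm_nat {n : ℕ} (hn : 1 ≤ n) :
    Summable (fun m : ℕ ↦ 1 / (classicalLocationZ n - classicalLocationZ ((m : ℤ) + 1)) +
      1 / (classicalLocationZ n + classicalLocationZ ((m : ℤ) + 1))) := by
  obtain ⟨K, hK, htail⟩ := exists_pairedTail_le
  have hnZ : (1 : ℤ) ≤ (n : ℤ) := by exact_mod_cast hn
  have hnZ0 : (0 : ℤ) < (n : ℤ) := by omega
  have hξn0 : 0 < classicalLocationZ (n : ℤ) := classicalLocationZ_pos hnZ0
  -- the shifted majorant
  have hg : Summable (fun m : ℕ ↦ K * classicalLocationZ (n : ℤ) *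
      (logPlus (((m + (2 * n + 1) : ℕ) : ℝ)) ^ 2 / (((m + (2 * n + 1) : ℕ) : ℝ)) ^ 2)) :=
    ((summable_nat_add_iff (2 * n + 1)).2 summable_logPlus_sq_div_sq).mul_left _
  refine (summable_nat_add_iff (2 * n)).1 (Summable.of_norm_bounded hg fun m ↦ ?_)
  have hm1 : ((m + 2 * n : ℕ) : ℤ) + 1 ≠ (n : ℤ) := by omega
  have hm2 : ((m + 2 * n : ℕ) : ℤ) + 1 ≠ -(n : ℤ) := by omega
  rw [Real.norm_eq_abs, pairedTerm_eq hm1 hm2]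
  have h3 := htail (n : ℤ) (((m + 2 * n : ℕ) : ℤ) + 1) hnZ (by push_cast; omega)
  have e : ((((m + 2 * n : ℕ) : ℤ) + 1 : ℤ) : ℝ) = ((m + (2 * n + 1) : ℕ) : ℝ) := by push_cast; ring
  rw [e] at h3
  exact h3

/-- Oddness of the paired terms in `k`. [cite: RodgersTaoFMP2020, §3 p. 21 (ξ_{−j} = −ξ_j)] -/
theorem pairedTerm_neg (k : ℤ) (m : ℕ) :
    1 / (classicalLocationZ (-k) - classicalLocationZ ((m : ℤ) + 1)) +
        1 / (classicalLocationZ (-k) + classicalLocationZ ((m : ℤ) + 1)) =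
      -(1 / (classicalLocationZ k - classicalLocationZ ((m : ℤ) + 1)) +
        1 / (classicalLocationZ k + classicalLocationZ ((m : ℤ) + 1))) := by
  rw [classicalLocationZ_neg]
  have e1 : -classicalLocationZ k - classicalLocationZ ((m : ℤ) + 1) =
      -(classicalLocationZ k + classicalLocationZ ((m : ℤ) + 1)) := by ring
  have e2 : -classicalLocationZ k + classicalLocationZ ((m : ℤ) + 1) =
      -(classicalLocationZ k - classicalLocationZ ((m : ℤ) + 1)) := by ring
  rw [e1, e2, div_neg, div_neg]
  ring

/-- For every `k ∈ ℤ*` the paired terms `1/(ξ_k − ξ_{m+1}) + 1/(ξ_k + ξ_{m+1})` are summable in `m`.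
[cite: RodgersTaoFMP2020, §1.2 p. 7; Lemma 8 p. 21] -/
theorem summable_pairedTerm {k : ℤ} (hk : k ≠ 0) :
    Summable (fun m : ℕ ↦ 1 / (classicalLocationZ k - classicalLocationZ ((m : ℤ) + 1)) +
      1 / (classicalLocationZ k + classicalLocationZ ((m : ℤ) + 1))) := by
  rcases lt_or_gt_of_ne hk with hneg | hpos
  · have hn : 1 ≤ (-k).toNat := by omega
    have hk' : (((-k).toNat : ℕ) : ℤ) = -k := Int.toNat_of_nonneg (by omega)
    have h := (summable_pairedTerm_nat hn).neg
    rw [hk'] at h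
    refine h.congr fun m ↦ ?_
    have := pairedTerm_neg (-k) m
    rw [neg_neg] at this
    rw [this]
  · have hn : 1 ≤ k.toNat := by omega
    have hk' : ((k.toNat : ℕ) : ℤ) = k := Int.toNat_of_nonneg hpos.le
    have h := summable_pairedTerm_nat hn
    rwa [hk'] at h

/-- **Convergence of the principal value.** For `k ∈ ℤ*` the truncations
`Σ_{i ∈ [−J,J]_{ℤ*}, i ≠ k} 1/(ξ_k − ξ_i)` converge, as `J → ∞`, to
`Σ'_{m ≥ 0} (1/(ξ_k − ξ_{m+1}) + 1/(ξ_k + ξ_{m+1}))`.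
[cite: RodgersTaoFMP2020, §1.2 p. 7 (principal value); Prop. 22 p. 50 (sumjk-2)] -/
theorem tendsto_xiPVPartialSum_tsum {k : ℤ} (hk : k ≠ 0) :
    Tendsto (xiPVPartialSum k) atTop
      (𝓝 (∑' m : ℕ, (1 / (classicalLocationZ k - classicalLocationZ ((m : ℤ) + 1)) +
        1 / (classicalLocationZ k + classicalLocationZ ((m : ℤ) + 1))))) := by
  have h := (summable_pairedTerm hk).hasSum.tendsto_sum_nat
  refine h.congr fun J ↦ ?_
  exact (xiPVPartialSum_eq_sum_range k J).symm

/-- The principal value `xiPVSum k` equals the series of paired terms (`k ∈ ℤ*`).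
[cite: RodgersTaoFMP2020, §1.2 p. 7; Prop. 22 p. 50 (sumjk-2)] -/
theorem xiPVSum_eq_tsum {k : ℤ} (hk : k ≠ 0) :
    xiPVSum k = ∑' m : ℕ, (1 / (classicalLocationZ k - classicalLocationZ ((m : ℤ) + 1)) +
      1 / (classicalLocationZ k + classicalLocationZ ((m : ℤ) + 1))) :=
  xiPVSum_eq_of_tendsto (tendsto_xiPVPartialSum_tsum hk)

end RodgersTaoXiPV

/-- **The principal value sum `Σ'_{i ≠ k} 1/(ξ_k − ξ_i)` converges** for every `k ∈ ℤ*`: the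
truncations over `[−J, J]_{ℤ*} ∖ {k}` tend to `xiPVSum k` as `J → ∞`.
[cite: RodgersTaoFMP2020, §1.2 p. 7 (principal value); Prop. 22 p. 50 (sumjk-2)] -/
theorem tendsto_xiPVPartialSum {k : ℤ} (hk : k ≠ 0) :
    Tendsto (xiPVPartialSum k) atTop (𝓝 (xiPVSum k)) := by
  rw [RodgersTaoXiPV.xiPVSum_eq_tsum hk]
  exact RodgersTaoXiPV.tendsto_xiPVPartialSum_tsum hk

/-- Oddness: `Σ'_{i ≠ −k} 1/(ξ_{−k} − ξ_i) = −Σ'_{i ≠ k} 1/(ξ_k − ξ_i)` for `k ∈ ℤ*`.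
[cite: RodgersTaoFMP2020, §3 p. 21 (ξ_{−j} = −ξ_j)] -/
theorem xiPVSum_neg {k : ℤ} (hk : k ≠ 0) : xiPVSum (-k) = -xiPVSum k := by
  have h := (tendsto_xiPVPartialSum hk).neg
  have h' : Tendsto (xiPVPartialSum (-k)) atTop (𝓝 (-xiPVSum k)) := by
    refine h.congr fun J ↦ ?_
    exact (RodgersTaoXiPV.xiPVPartialSum_neg k J).symm
  exact xiPVSum_eq_of_tendsto h'

namespace RodgersTaoXiPV


/-! ## The bound `|Σ'_{i ≠ k} 1/(ξ_k − ξ_i)| ≤ C log₊ k` -/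

/-- Reindexing `m ↦ i = m + 1`: `Σ_{m < M} f(m+1) = Σ_{i ∈ [1, M]} f(i)`. [folklore] -/
private theorem sum_range_succ_shift (f : ℤ → ℝ) (M : ℕ) :
    ∑ m ∈ Finset.range M, f ((m : ℤ) + 1) = ∑ i ∈ Finset.Ico 1 (M + 1), f (i : ℤ) := by
  rw [Finset.sum_Ico_eq_sum_range, Nat.add_sub_cancel]
  refine Finset.sum_congr rfl fun m _ ↦ ?_
  congr 1
  push_cast
  ring

/-- `|1/x| = 1/|x|`. [folklore] -/
private theorem abs_one_div' (x : ℝ) : |1 / x| = 1 / |x| := by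
  rw [abs_div, abs_one]

/-- The near pairs `i = n ± m`, `1 ≤ m ≤ w` (with `2w ≤ n`, `A w ≤ 2πn`): by the (45)-pairing each
pair is `≤ A/(2π²n)` in absolute value, so `|Σ_{i ∈ [n−w, n+w]} 1/(ξ_n − ξ_i)| ≤ w · A/(2π²n)`
(the term `i = n` being `0`). [cite: RodgersTaoFMP2020, Lemma 8 (iii) (45) p. 21; §7 p. 44 (stat)] -/
private theorem abs_sum_near_le {A : ℝ} (hA0 : 0 ≤ A)
    (hpair : ∀ j m : ℤ, 1 ≤ m → 2 * m ≤ j → A * m ≤ 2 * π * j →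
      |1 / (classicalLocationZ j - classicalLocationZ (j + m)) +
          1 / (classicalLocationZ j - classicalLocationZ (j - m))| ≤ A / (2 * π ^ 2 * j))
    (n : ℕ) :
    ∀ w : ℕ, 2 * w ≤ n → A * w ≤ 2 * π * n →
      |∑ i ∈ Finset.Ico (n - w) (n + w + 1),
          1 / (classicalLocationZ n - classicalLocationZ (i : ℤ))| ≤ w * (A / (2 * π ^ 2 * n)) := by
  intro w
  induction w with
  | zero =>
    intro _ _
    simp
  | succ w ih =>
    intro h2 hA
    have hw2 : 2 * w ≤ n := by omega
    have hAw : A * w ≤ 2 * π * n := by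
      refine le_trans ?_ hA
      gcongr
      · linarith
    have hrec := ih hw2 hAw
    have e1 : Finset.Ico (n - (w + 1)) (n + (w + 1) + 1) =
        insert (n - (w + 1)) (Finset.Ico (n - w) (n + (w + 1) + 1)) := by
      have : n - (w + 1) + 1 = n - w := by omega
      rw [← Finset.insert_Ico_add_one_left_eq_Ico
        (show n - (w + 1) < n + (w + 1) + 1 by omega), this]
    have e2 : Finset.Ico (n - w) (n + (w + 1) + 1) =
        insert (n + w + 1) (Finset.Ico (n - w) (n + w + 1)) := by
      rw [show n + (w + 1) + 1 = (n + w + 1) + 1 by ring,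
        ← Finset.insert_Ico_right_eq_Ico_add_one (show n - w ≤ n + w + 1 by omega)]
    have hnot1 : n - (w + 1) ∉ Finset.Ico (n - w) (n + (w + 1) + 1) := by
      simp only [Finset.mem_Ico, not_and, not_lt]; omega
    have hnot2 : n + w + 1 ∉ Finset.Ico (n - w) (n + w + 1) := by simp
    rw [e1, Finset.sum_insert hnot1, e2, Finset.sum_insert hnot2, ← add_assoc]
    -- the new pair
    have hp := hpair (n : ℤ) ((w + 1 : ℕ) : ℤ) (by push_cast; omega) (by push_cast; omega)
      (by push_cast at hA ⊢; linarith)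
    have c1 : (n : ℤ) + ((w + 1 : ℕ) : ℤ) = ((n + w + 1 : ℕ) : ℤ) := by push_cast; ring
    have c2 : (n : ℤ) - ((w + 1 : ℕ) : ℤ) = ((n - (w + 1) : ℕ) : ℤ) := by
      rw [Nat.cast_sub (by omega)]
    rw [c1, c2, add_comm] at hp
    calc |1 / (classicalLocationZ n - classicalLocationZ ((n - (w + 1) : ℕ) : ℤ)) +
            1 / (classicalLocationZ n - classicalLocationZ ((n + w + 1 : ℕ) : ℤ)) +
            ∑ i ∈ Finset.Ico (n - w) (n + w + 1),
              1 / (classicalLocationZ n - classicalLocationZ (i : ℤ))|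
        ≤ |1 / (classicalLocationZ n - classicalLocationZ ((n - (w + 1) : ℕ) : ℤ)) +
            1 / (classicalLocationZ n - classicalLocationZ ((n + w + 1 : ℕ) : ℤ))| +
            |∑ i ∈ Finset.Ico (n - w) (n + w + 1),
              1 / (classicalLocationZ n - classicalLocationZ (i : ℤ))| := abs_add_le _ _
      _ ≤ A / (2 * π ^ 2 * n) + w * (A / (2 * π ^ 2 * n)) := add_le_add hp hrec
      _ = ((w + 1 : ℕ) : ℝ) * (A / (2 * π ^ 2 * n)) := by push_cast; ring

/-- The far positive indices on the left, `1 ≤ i < n − W`: each `1/(ξ_n − ξ_i)` is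
`≤ C log₊(2n)/(W + 1)` by (44), and there are fewer than `n` of them.
[cite: RodgersTaoFMP2020, Lemma 8 (ii) (44) p. 21; Prop. 22 p. 51] -/
private theorem abs_sum_farLeft_le {C : ℝ} (hC : 0 < C)
    (h44 : ∀ j k : ℤ, j ≠ 0 → k ≠ 0 →
      1 / |classicalLocationZ j - classicalLocationZ k| ≤
        C * (logPlus (|(j : ℝ)| + |(k : ℝ)|) / |(j : ℝ) - k|))
    {n W : ℕ} (hn : 1 ≤ n) {c : ℝ} (hc : 0 < c) (hcW : c * n ≤ W + 1) :
    |∑ i ∈ Finset.Ico 1 (n - W), 1 / (classicalLocationZ n - classicalLocationZ (i : ℤ))| ≤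
      2 * C / c * logPlus (n : ℝ) := by
  have hn0 : (0 : ℝ) < n := by exact_mod_cast hn
  have hW1 : (0 : ℝ) < W + 1 := by positivity
  have hLn : 0 ≤ logPlus (n : ℝ) := logPlus_nonneg _
  have hterm : ∀ i ∈ Finset.Ico 1 (n - W),
      |1 / (classicalLocationZ n - classicalLocationZ (i : ℤ))| ≤
        2 * C * logPlus (n : ℝ) / (W + 1) := by
    intro i hi
    rw [Finset.mem_Ico] at hi
    have hi0 : (i : ℝ) ≤ n := by exact_mod_cast (show i ≤ n by omega)
    have hi1 : (1 : ℝ) ≤ i := by exact_mod_cast hi.1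
    have hni : (W : ℝ) + 1 ≤ (n : ℝ) - i := by
      have : W + 1 ≤ n - i := by omega
      have h' : ((W + 1 : ℕ) : ℝ) ≤ ((n - i : ℕ) : ℝ) := by exact_mod_cast this
      rw [Nat.cast_sub (by omega)] at h'
      push_cast at h'
      exact h'
    have h := h44 (n : ℤ) (i : ℤ) (by omega) (by omega)
    push_cast at h
    rw [abs_of_pos hn0, abs_of_pos (by linarith : (0 : ℝ) < i),
      abs_of_pos (by linarith : (0 : ℝ) < (n : ℝ) - i)] at h
    have hlog : logPlus ((n : ℝ) + i) ≤ 2 * logPlus (n : ℝ) :=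
      calc logPlus ((n : ℝ) + i) ≤ logPlus (2 * (n : ℝ)) :=
            logPlus_mono (by rw [abs_of_pos (by positivity), abs_of_pos (by positivity)]; linarith)
        _ ≤ 2 * logPlus (n : ℝ) := logPlus_two_mul_le hn0.le
    calc |1 / (classicalLocationZ n - classicalLocationZ (i : ℤ))|
        = 1 / |classicalLocationZ n - classicalLocationZ (i : ℤ)| := abs_one_div' _
      _ ≤ C * (logPlus ((n : ℝ) + i) / ((n : ℝ) - i)) := h
      _ ≤ C * (2 * logPlus (n : ℝ) / (W + 1)) := by
          refine mul_le_mul_of_nonneg_left ?_ hC.le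
          calc logPlus ((n : ℝ) + i) / ((n : ℝ) - i) ≤ 2 * logPlus (n : ℝ) / ((n : ℝ) - i) :=
                div_le_div_of_nonneg_right hlog (by linarith)
            _ ≤ 2 * logPlus (n : ℝ) / (W + 1) :=
                div_le_div_of_nonneg_left (by positivity) hW1 hni
      _ = 2 * C * logPlus (n : ℝ) / (W + 1) := by ring
  have hB0 : 0 ≤ 2 * C * logPlus (n : ℝ) / (W + 1) := div_nonneg (by positivity) hW1.le
  calc |∑ i ∈ Finset.Ico 1 (n - W), 1 / (classicalLocationZ n - classicalLocationZ (i : ℤ))|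
      ≤ ∑ i ∈ Finset.Ico 1 (n - W), |1 / (classicalLocationZ n - classicalLocationZ (i : ℤ))| :=
        Finset.abs_sum_le_sum_abs _ _
    _ ≤ ∑ i ∈ Finset.Ico 1 (n - W), 2 * C * logPlus (n : ℝ) / (W + 1) := Finset.sum_le_sum hterm
    _ = ((n - W - 1 : ℕ) : ℝ) * (2 * C * logPlus (n : ℝ) / (W + 1)) := by
        rw [Finset.sum_const, Nat.card_Ico, nsmul_eq_mul]
    _ ≤ (n : ℝ) * (2 * C * logPlus (n : ℝ) / (W + 1)) := by
        refine mul_le_mul_of_nonneg_right ?_ hB0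
        exact_mod_cast (show n - W - 1 ≤ n by omega)
    _ = 2 * C * logPlus (n : ℝ) * ((n : ℝ) / (W + 1)) := by ring
    _ ≤ 2 * C * logPlus (n : ℝ) * (1 / c) := by
        refine mul_le_mul_of_nonneg_left ?_ (by positivity)
        rw [div_le_div_iff₀ hW1 hc]; linarith
    _ = 2 * C / c * logPlus (n : ℝ) := by ring

/-- The far positive indices on the right, `n + W < i ≤ 2n`: each `|1/(ξ_n − ξ_i)|` is
`≤ C log₊(3n)/(W + 1)` by (44), and there are at most `n` of them.
[cite: RodgersTaoFMP2020, Lemma 8 (ii) (44) p. 21; Prop. 22 p. 51] -/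
private theorem abs_sum_midRight_le {C : ℝ} (hC : 0 < C)
    (h44 : ∀ j k : ℤ, j ≠ 0 → k ≠ 0 →
      1 / |classicalLocationZ j - classicalLocationZ k| ≤
        C * (logPlus (|(j : ℝ)| + |(k : ℝ)|) / |(j : ℝ) - k|))
    {n W : ℕ} (hn : 1 ≤ n) {c : ℝ} (hc : 0 < c) (hcW : c * n ≤ W + 1) :
    |∑ i ∈ Finset.Ico (n + W + 1) (2 * n + 1),
        1 / (classicalLocationZ n - classicalLocationZ (i : ℤ))| ≤ 3 * C / c * logPlus (n : ℝ) := by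
  have hn0 : (0 : ℝ) < n := by exact_mod_cast hn
  have hW1 : (0 : ℝ) < W + 1 := by positivity
  have hLn : 0 ≤ logPlus (n : ℝ) := logPlus_nonneg _
  have hterm : ∀ i ∈ Finset.Ico (n + W + 1) (2 * n + 1),
      |1 / (classicalLocationZ n - classicalLocationZ (i : ℤ))| ≤
        3 * C * logPlus (n : ℝ) / (W + 1) := by
    intro i hi
    rw [Finset.mem_Ico] at hi
    have hi0 : (i : ℝ) ≤ 2 * n := by exact_mod_cast (show i ≤ 2 * n by omega)
    have hin : (W : ℝ) + 1 ≤ (i : ℝ) - n := by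
      have : ((n + W + 1 : ℕ) : ℝ) ≤ i := by exact_mod_cast hi.1
      push_cast at this; linarith
    have h := h44 (n : ℤ) (i : ℤ) (by omega) (by omega)
    push_cast at h
    rw [abs_of_pos hn0, abs_of_pos (by linarith : (0 : ℝ) < i), abs_sub_comm ((n : ℕ) : ℝ) (i : ℝ),
      abs_of_pos (by linarith : (0 : ℝ) < (i : ℝ) - n)] at h
    have hlog : logPlus ((n : ℝ) + i) ≤ 3 * logPlus (n : ℝ) :=
      calc logPlus ((n : ℝ) + i) ≤ logPlus ((n : ℝ) + 2 * n) :=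
            logPlus_mono (by rw [abs_of_pos (by positivity), abs_of_pos (by positivity)]; linarith)
        _ ≤ logPlus (n : ℝ) + logPlus (2 * (n : ℝ)) := logPlus_add_le hn0.le (by positivity)
        _ ≤ logPlus (n : ℝ) + 2 * logPlus (n : ℝ) := by
            have := logPlus_two_mul_le hn0.le; linarith
        _ = 3 * logPlus (n : ℝ) := by ring
    calc |1 / (classicalLocationZ n - classicalLocationZ (i : ℤ))|
        = 1 / |classicalLocationZ n - classicalLocationZ (i : ℤ)| := abs_one_div' _
      _ ≤ C * (logPlus ((n : ℝ) + i) / ((i : ℝ) - n)) := h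
      _ ≤ C * (3 * logPlus (n : ℝ) / (W + 1)) := by
          refine mul_le_mul_of_nonneg_left ?_ hC.le
          calc logPlus ((n : ℝ) + i) / ((i : ℝ) - n) ≤ 3 * logPlus (n : ℝ) / ((i : ℝ) - n) :=
                div_le_div_of_nonneg_right hlog (by linarith)
            _ ≤ 3 * logPlus (n : ℝ) / (W + 1) :=
                div_le_div_of_nonneg_left (by positivity) hW1 hin
      _ = 3 * C * logPlus (n : ℝ) / (W + 1) := by ring
  have hB0 : 0 ≤ 3 * C * logPlus (n : ℝ) / (W + 1) := div_nonneg (by positivity) hW1.le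
  calc |∑ i ∈ Finset.Ico (n + W + 1) (2 * n + 1),
          1 / (classicalLocationZ n - classicalLocationZ (i : ℤ))|
      ≤ ∑ i ∈ Finset.Ico (n + W + 1) (2 * n + 1),
          |1 / (classicalLocationZ n - classicalLocationZ (i : ℤ))| := Finset.abs_sum_le_sum_abs _ _
    _ ≤ ∑ i ∈ Finset.Ico (n + W + 1) (2 * n + 1), 3 * C * logPlus (n : ℝ) / (W + 1) :=
        Finset.sum_le_sum hterm
    _ = ((2 * n + 1 - (n + W + 1) : ℕ) : ℝ) * (3 * C * logPlus (n : ℝ) / (W + 1)) := by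
        rw [Finset.sum_const, Nat.card_Ico, nsmul_eq_mul]
    _ ≤ (n : ℝ) * (3 * C * logPlus (n : ℝ) / (W + 1)) := by
        refine mul_le_mul_of_nonneg_right ?_ hB0
        exact_mod_cast (show 2 * n + 1 - (n + W + 1) ≤ n by omega)
    _ = 3 * C * logPlus (n : ℝ) * ((n : ℝ) / (W + 1)) := by ring
    _ ≤ 3 * C * logPlus (n : ℝ) * (1 / c) := by
        refine mul_le_mul_of_nonneg_left ?_ (by positivity)
        rw [div_le_div_iff₀ hW1 hc]; linarith
    _ = 3 * C / c * logPlus (n : ℝ) := by ring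

/-- **`|Σ'_{i ≠ n} 1/(ξ_n − ξ_i)| ≤ C log₊ n` for positive integers `n`**, an absolute `C`.
Printed: «from (xikjd), (44), and the triangle inequality we also see that
`Σ'_{i ≠ k} 1/(ξ_k − ξ_i) = O(log T)`»; here for all `n ≥ 1`: near pairs by (45), the remaining
indices `1 ≤ i ≤ 2n` by (44), the opposite-sign indices by `1/(ξ_n + ξ_i) ≤ 1/ξ_n ≪ log₊ n/n`,
and the paired tail `i > 2n` by `exists_sum_pairedTail_le`.
[cite: RodgersTaoFMP2020, Prop. 22 p. 51; Lemma 8 (43)–(45) p. 21] -/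
theorem exists_abs_xiPVSum_natCast_le :
    ∃ C : ℝ, 0 < C ∧ ∀ n : ℕ, 1 ≤ n → |xiPVSum (n : ℤ)| ≤ C * logPlus (n : ℝ) := by
  obtain ⟨A, hA0, hpair⟩ := exists_pair_inv_sub_classicalLocationZ_le
  obtain ⟨C₄₄, hC₄₄, h44⟩ := exists_inv_abs_sub_classicalLocationZ_le
  obtain ⟨c₁, C₁, hc₁, -, h8⟩ := lemma8_i_order
  obtain ⟨K, hK0, hK⟩ := exists_sum_pairedTail_le
  have hπ : 0 < π := Real.pi_pos
  -- the near-window fraction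
  set c : ℝ := min (1 / 2) (π / (A + 1)) with hcdef
  have hc0 : 0 < c := lt_min (by norm_num) (by positivity)
  have hc2 : c ≤ 1 / 2 := min_le_left _ _
  have hcA : c ≤ π / (A + 1) := min_le_right _ _
  refine ⟨2 * C₄₄ / c + A / (2 * π ^ 2) + 3 * C₄₄ / c + 2 / c₁ + K, by positivity, fun n hn ↦ ?_⟩
  have hn0 : (0 : ℝ) < n := by exact_mod_cast hn
  have hnZ0 : (0 : ℤ) < (n : ℤ) := by exact_mod_cast hn
  have hlog2 : (1 : ℝ) / 2 ≤ logPlus (n : ℝ) := by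
    have h1 := Real.log_two_gt_d9
    have h2 := log_two_le_logPlus (n : ℝ)
    linarith
  have hL0 : 0 < logPlus (n : ℝ) := logPlus_pos _
  -- the window `W = ⌊c n⌋`
  set W : ℕ := ⌊c * n⌋₊ with hWdef
  have hWle : (W : ℝ) ≤ c * n := Nat.floor_le (by positivity)
  have hWlt : c * n < W + 1 := Nat.lt_floor_add_one _
  have hWhalf : (W : ℝ) ≤ n / 2 := hWle.trans (by nlinarith)
  have h2W : 2 * W ≤ n := by
    have : (2 * W : ℝ) ≤ n := by linarith
    exact_mod_cast this
  have hWn : W + 1 ≤ n := by omega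
  have hAW : A * W ≤ 2 * π * n := by
    have h1 : A * W ≤ A * (c * n) := mul_le_mul_of_nonneg_left hWle hA0
    have h2 : A * c ≤ π := by
      calc A * c ≤ A * (π / (A + 1)) := mul_le_mul_of_nonneg_left hcA hA0
        _ = π * (A / (A + 1)) := by ring
        _ ≤ π * 1 := by
            gcongr
            rw [div_le_one (by positivity)]; linarith
        _ = π := mul_one π
    nlinarith
  -- notation for the paired terms
  set w : ℕ → ℝ := fun m ↦ 1 / (classicalLocationZ n - classicalLocationZ ((m : ℤ) + 1)) +
      1 / (classicalLocationZ n + classicalLocationZ ((m : ℤ) + 1)) with hw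
  have hsw : Summable w := summable_pairedTerm_nat hn
  have hP : xiPVSum (n : ℤ) = ∑' m, w m := xiPVSum_eq_tsum (by omega)
  have hsplit : ∑' m, w m = ∑ m ∈ Finset.range (2 * n), w m + ∑' m, w (m + 2 * n) :=
    (hsw.sum_add_tsum_nat_add (2 * n)).symm
  -- (1) the tail beyond `2n`
  have hswt : Summable (fun m ↦ w (m + 2 * n)) := (summable_nat_add_iff (2 * n)).2 hsw
  have htail : |∑' m, w (m + 2 * n)| ≤ K * logPlus (n : ℝ) := by
    have h1 : ‖∑' m, w (m + 2 * n)‖ ≤ ∑' m, ‖w (m + 2 * n)‖ := norm_tsum_le_tsum_norm hswt.norm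
    simp only [Real.norm_eq_abs] at h1
    refine h1.trans (hswt.abs.tsum_le_of_sum_le fun S ↦ ?_)
    have hS' : ∀ m ∈ S.map ⟨fun m ↦ m + 2 * n, add_left_injective (2 * n)⟩, 2 * n ≤ m + 1 := by
      intro m hm
      rw [Finset.mem_map] at hm
      obtain ⟨m', -, rfl⟩ := hm
      simp only [Function.Embedding.coeFn_mk]
      omega
    have := hK n hn _ hS'
    rw [Finset.sum_map] at this
    simp only [Function.Embedding.coeFn_mk, Nat.cast_add, Nat.cast_mul, Nat.cast_ofNat] at this
    refine le_of_eq_of_le ?_ this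
    refine Finset.sum_congr rfl fun m _ ↦ ?_
    simp only [hw]
    push_cast
    ring_nf
  -- (2) the head `m < 2n`, split into the `ξ_n − ξ_i` and `ξ_n + ξ_i` parts
  set u : ℕ → ℝ := fun i ↦ 1 / (classicalLocationZ n - classicalLocationZ (i : ℤ)) with hu
  have hhead : ∑ m ∈ Finset.range (2 * n), w m =
      ∑ i ∈ Finset.Ico 1 (2 * n + 1), u i +
        ∑ m ∈ Finset.range (2 * n), 1 / (classicalLocationZ n + classicalLocationZ ((m : ℤ) + 1)) := by
    simp only [hw, Finset.sum_add_distrib]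
    rw [sum_range_succ_shift (fun i ↦ 1 / (classicalLocationZ n - classicalLocationZ i)) (2 * n)]
  -- (2a) the opposite-sign part
  have hξn_lo : c₁ * ((n : ℝ) / logPlus (n : ℝ)) ≤ classicalLocationZ (n : ℤ) := by
    rw [classicalLocationZ_of_pos hnZ0]
    have := (h8 (n : ℝ) (by exact_mod_cast hn)).1
    exact_mod_cast this
  have hξn0 : 0 < classicalLocationZ (n : ℤ) := classicalLocationZ_pos hnZ0
  have hv : |∑ m ∈ Finset.range (2 * n),
      1 / (classicalLocationZ n + classicalLocationZ ((m : ℤ) + 1))| ≤ 2 / c₁ * logPlus (n : ℝ) := by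
    have hvt : ∀ m ∈ Finset.range (2 * n),
        0 ≤ 1 / (classicalLocationZ n + classicalLocationZ ((m : ℤ) + 1)) ∧
        1 / (classicalLocationZ n + classicalLocationZ ((m : ℤ) + 1)) ≤ 1 / classicalLocationZ n := by
      intro m _
      have hm0 : 0 < classicalLocationZ ((m : ℤ) + 1) := classicalLocationZ_pos (by omega)
      exact ⟨by positivity, div_le_div_of_nonneg_left zero_le_one hξn0 (by linarith)⟩
    rw [abs_of_nonneg (Finset.sum_nonneg fun m hm ↦ (hvt m hm).1)]
    calc ∑ m ∈ Finset.range (2 * n), 1 / (classicalLocationZ n + classicalLocationZ ((m : ℤ) + 1))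
        ≤ ∑ m ∈ Finset.range (2 * n), 1 / classicalLocationZ n :=
          Finset.sum_le_sum fun m hm ↦ (hvt m hm).2
      _ = 2 * n * (1 / classicalLocationZ n) := by
          rw [Finset.sum_const, Finset.card_range, nsmul_eq_mul]; push_cast; ring
      _ ≤ 2 * n * (1 / (c₁ * ((n : ℝ) / logPlus (n : ℝ)))) := by
          gcongr
      _ = 2 / c₁ * logPlus (n : ℝ) := by field_simp
  -- (2b) the `u`-part: far left + near + mid right
  have hsplit_u : ∑ i ∈ Finset.Ico 1 (2 * n + 1), u i =
      ∑ i ∈ Finset.Ico 1 (n - W), u i + ∑ i ∈ Finset.Ico (n - W) (n + W + 1), u i +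
        ∑ i ∈ Finset.Ico (n + W + 1) (2 * n + 1), u i := by
    rw [Finset.sum_Ico_consecutive u (show 1 ≤ n - W by omega) (show n - W ≤ n + W + 1 by omega),
      Finset.sum_Ico_consecutive u (show 1 ≤ n + W + 1 by omega) (show n + W + 1 ≤ 2 * n + 1 by omega)]
  have hfar := abs_sum_farLeft_le hC₄₄ h44 hn hc0 hWlt.le (W := W)
  have hnear := abs_sum_near_le hA0 (fun j m h1 h2 h3 ↦ (hpair j m h1 h2 h3).2.2) n W h2W hAW
  have hmid := abs_sum_midRight_le hC₄₄ h44 hn hc0 hWlt.le (W := W)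
  have hnear' : (W : ℝ) * (A / (2 * π ^ 2 * n)) ≤ A / (2 * π ^ 2) * logPlus (n : ℝ) := by
    calc (W : ℝ) * (A / (2 * π ^ 2 * n)) ≤ (n / 2) * (A / (2 * π ^ 2 * n)) :=
          mul_le_mul_of_nonneg_right hWhalf (by positivity)
      _ = A / (2 * π ^ 2) * (1 / 2) := by field_simp
      _ ≤ A / (2 * π ^ 2) * logPlus (n : ℝ) := mul_le_mul_of_nonneg_left hlog2 (by positivity)
  have hU : |∑ i ∈ Finset.Ico 1 (2 * n + 1), u i| ≤
      (2 * C₄₄ / c + A / (2 * π ^ 2) + 3 * C₄₄ / c) * logPlus (n : ℝ) := by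
    rw [hsplit_u]
    calc |∑ i ∈ Finset.Ico 1 (n - W), u i + ∑ i ∈ Finset.Ico (n - W) (n + W + 1), u i +
            ∑ i ∈ Finset.Ico (n + W + 1) (2 * n + 1), u i|
        ≤ |∑ i ∈ Finset.Ico 1 (n - W), u i| + |∑ i ∈ Finset.Ico (n - W) (n + W + 1), u i| +
            |∑ i ∈ Finset.Ico (n + W + 1) (2 * n + 1), u i| := abs_add_three _ _ _
      _ ≤ 2 * C₄₄ / c * logPlus (n : ℝ) + A / (2 * π ^ 2) * logPlus (n : ℝ) +
            3 * C₄₄ / c * logPlus (n : ℝ) := add_le_add (add_le_add hfar (hnear.trans hnear')) hmid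
      _ = (2 * C₄₄ / c + A / (2 * π ^ 2) + 3 * C₄₄ / c) * logPlus (n : ℝ) := by ring
  -- assembly
  rw [hP, hsplit, hhead]
  calc |∑ i ∈ Finset.Ico 1 (2 * n + 1), u i +
          ∑ m ∈ Finset.range (2 * n), 1 / (classicalLocationZ n + classicalLocationZ ((m : ℤ) + 1)) +
          ∑' m, w (m + 2 * n)|
      ≤ |∑ i ∈ Finset.Ico 1 (2 * n + 1), u i| +
          |∑ m ∈ Finset.range (2 * n), 1 / (classicalLocationZ n + classicalLocationZ ((m : ℤ) + 1))| +
          |∑' m, w (m + 2 * n)| := abs_add_three _ _ _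
    _ ≤ (2 * C₄₄ / c + A / (2 * π ^ 2) + 3 * C₄₄ / c) * logPlus (n : ℝ) +
          2 / c₁ * logPlus (n : ℝ) + K * logPlus (n : ℝ) := add_le_add (add_le_add hU hv) htail
    _ = (2 * C₄₄ / c + A / (2 * π ^ 2) + 3 * C₄₄ / c + 2 / c₁ + K) * logPlus (n : ℝ) := by ring

end RodgersTaoXiPV

/-- **`Σ'_{i ≠ k} 1/(ξ_k − ξ_i) = O(log₊ k)`**: there is an absolute `C` with
`|xiPVSum k| ≤ C log₊ k` for every `k ∈ ℤ*` (printed as «`= O(log T)`», FMP p. 51, for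
`|k| ≤ T^{1.5}`; RH-free, `t`-free). [cite: RodgersTaoFMP2020, Prop. 22 p. 51; Lemma 8 (43)–(45) p. 21] -/
theorem abs_xiPVSum_le :
    ∃ C : ℝ, 0 < C ∧ ∀ k : ℤ, k ≠ 0 → |xiPVSum k| ≤ C * logPlus (k : ℝ) := by
  obtain ⟨C, hC, h⟩ := RodgersTaoXiPV.exists_abs_xiPVSum_natCast_le
  refine ⟨C, hC, fun k hk ↦ ?_⟩
  rcases lt_or_gt_of_ne hk with hneg | hpos
  · have hn : 1 ≤ (-k).toNat := by omega
    have hk' : (((-k).toNat : ℕ) : ℤ) = -k := Int.toNat_of_nonneg (by omega)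
    have h1 := h (-k).toNat hn
    rw [hk', xiPVSum_neg hk, abs_neg] at h1
    have e : (((-k).toNat : ℕ) : ℝ) = -(k : ℝ) := by exact_mod_cast hk'
    rwa [e, logPlus_neg] at h1
  · have hn : 1 ≤ k.toNat := by omega
    have hk' : ((k.toNat : ℕ) : ℤ) = k := Int.toNat_of_nonneg hpos.le
    have h1 := h k.toNat hn
    rw [hk'] at h1
    have e : ((k.toNat : ℕ) : ℝ) = (k : ℝ) := by exact_mod_cast hk'
    rwa [e] at h1

/-! ## (sumjk-2) is negligible -/

/-- **Rodgers–Tao 2020, proof of Proposition 22: «(sumjk-2) is negligible»** (FMP p. 51). For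
every `ε > 0` there is `T₁` such that for all `T ≥ T₁` the family
`(k, j) ↦ ψ_T(k)ψ_T(j) · (1/(ξ_k − ξ_j)) · Σ'_{i ≠ k} 1/(ξ_k − ξ_i)` on the nearby pairs `k ∼_T j`
(`k, j ∈ ℤ*`) is summable and
`|Σ_{k ∼_T j} ψ_T(k)ψ_T(j) (1/(ξ_k − ξ_j)) Σ'_{i ≠ k} 1/(ξ_k − ξ_i)| ≤ ε · T log³ T`.
Printed road: «The expression (sumjk-2) may be rearranged as
`Σ_k ψ_T(k)(Σ_{j ∼_T k} ψ_T(j)/(ξ_k − ξ_j))(Σ'_{i ≠ k} 1/(ξ_k − ξ_i))` … (souse) … `= O(log T)` … Thus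
(sumjk-2) is negligible»; here: Fubini over `ℤ × ℤ` (majorant `ψ_T(k)(2+|k|)² · ψ_T(j)(2+|j|)`),
the row sums `S_k(T) = Σ_j 1[(k,j) nearby] ψ_T(j)/(ξ_k − ξ_j)` of `RodgersTaoNearbySumsProofs`,
`abs_xiPVSum_le` with `log₊ k ≪ log₊ ξ_k` (Lemma 8 (i)), and (souse) in the form
`nearbyRow_weighted_tsum_le`. RH-free and `t`-free (no zeros of `H_t`, no `Λ`); «negligible» here
is the `t`-free `o_{T → ∞}(T log³ T)`.
[cite: RodgersTaoFMP2020, Prop. 22 pp. 50–51 (sumjk-2); §7 p. 44 (souse); Lemma 8 (43)–(45) p. 21] -/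
theorem sumjk2_negligible :
    ∀ ε : ℝ, 0 < ε → ∃ T₁ : ℝ, ∀ T : ℝ, T₁ ≤ T →
      Summable (fun p : nearbyPairs T ↦ truncWeight T p.1.1 * truncWeight T p.1.2 /
        (classicalLocationZ p.1.1 - classicalLocationZ p.1.2) * xiPVSum p.1.1) ∧
      |∑' p : nearbyPairs T, truncWeight T p.1.1 * truncWeight T p.1.2 /
        (classicalLocationZ p.1.1 - classicalLocationZ p.1.2) * xiPVSum p.1.1| ≤
        ε * (T * Real.log T ^ 3) := by
  intro ε hε
  obtain ⟨CP, hCP, hP⟩ := abs_xiPVSum_le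
  obtain ⟨c₁, C₁, hc₁, -, h8⟩ := lemma8_i_order
  obtain ⟨C₄₄, hC₄₄, h44⟩ := exists_inv_abs_sub_classicalLocationZ_le
  have hε' : 0 < ε * c₁ / CP := by positivity
  obtain ⟨T₁, hT₁16, hmain⟩ := nearbyRow_weighted_tsum_le (ε * c₁ / CP) hε'
  refine ⟨T₁, fun T hT ↦ ?_⟩
  have hT16 : 16 ≤ T := hT₁16.trans hT
  have hT1 : 1 < T := by linarith
  have hlogT : 0 < Real.log T := Real.log_pos hT1
  have hTL0 : 0 < T * Real.log T := mul_pos (by linarith) hlogT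
  obtain ⟨hsumS, hSle⟩ := hmain T hT
  -- notation: the row term of `RodgersTaoNearbySumsProofs` and the family on `ℤ × ℤ`
  set row : ℤ × ℤ → ℝ := (nearbyPairs T).indicator
    (fun p : ℤ × ℤ ↦ truncWeight T p.2 / (classicalLocationZ p.1 - classicalLocationZ p.2)) with hrow
  set f : ℤ × ℤ → ℝ := fun q ↦ truncWeight T q.1 * truncWeight T q.2 /
    (classicalLocationZ q.1 - classicalLocationZ q.2) * xiPVSum q.1 with hf
  set G : ℤ × ℤ → ℝ := fun q ↦ truncWeight T q.1 * xiPVSum q.1 * row q with hG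
  have hψ0 : ∀ j, 0 ≤ truncWeight T j := fun j ↦ (truncWeight_pos hTL0 j).le
  have hψ1 : ∀ j, truncWeight T j ≤ 1 := fun j ↦ truncWeight_le_one hTL0 j
  -- (A) the indicator of `f` is `G`
  have hA : (nearbyPairs T).indicator f = G := by
    funext q
    obtain ⟨k, j⟩ := q
    by_cases hq : (k, j) ∈ nearbyPairs T
    · rw [Set.indicator_of_mem hq]
      simp only [hG, hf, hrow]
      rw [nearbyRow_eq_of_mem hq]
      ring
    · rw [Set.indicator_of_notMem hq]
      simp only [hG, hrow]
      rw [nearbyRow_eq_zero hq, mul_zero]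
  -- (B) `log₊ k ≤ log₊(ξ_k)/c₁` for `k ∈ ℤ*`
  have hlogξ : ∀ k : ℤ, k ≠ 0 → logPlus (k : ℝ) ≤ logPlus (classicalLocationZ k) / c₁ := by
    have key : ∀ k : ℤ, 0 < k → logPlus (k : ℝ) ≤ logPlus (classicalLocationZ k) / c₁ := by
      intro k hk
      rw [le_div_iff₀ hc₁, classicalLocationZ_of_pos hk, mul_comm]
      exact (h8 (k : ℝ) (by exact_mod_cast hk)).2.2.1
    intro k hk
    rcases lt_or_gt_of_ne hk with hneg | hpos
    · have := key (-k) (by omega)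
      push_cast at this
      rwa [logPlus_neg, classicalLocationZ_neg, logPlus_neg] at this
    · exact key k hpos
  -- (C) the pointwise majorant `|G (k,j)| ≤ M₁ k * M₂ j`
  set M₁ : ℤ → ℝ := fun k ↦ CP * C₄₄ * (truncWeight T k * (2 + |(k : ℝ)|) ^ 2) with hM₁
  set M₂ : ℤ → ℝ := fun j ↦ truncWeight T j * (2 + |(j : ℝ)|) ^ 1 with hM₂
  have hM₁0 : ∀ k, 0 ≤ M₁ k := fun k ↦ by
    simp only [hM₁]
    exact mul_nonneg (by positivity) (mul_nonneg (hψ0 k) (by positivity))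
  have hM₂0 : ∀ j, 0 ≤ M₂ j := fun j ↦ by
    simp only [hM₂]
    exact mul_nonneg (hψ0 j) (by positivity)
  have hsM₁ : Summable M₁ :=
    (RodgersTaoTruncEnergyIntegrable.summable_truncWeight_mul_pow hTL0 (m := 2) (by norm_num)).mul_left _
  have hsM₂ : Summable M₂ :=
    RodgersTaoTruncEnergyIntegrable.summable_truncWeight_mul_pow hTL0 (m := 1) (by norm_num)
  have hmaj : Summable (fun q : ℤ × ℤ ↦ M₁ q.1 * M₂ q.2) := hsM₁.mul_of_nonneg hsM₂ hM₁0 hM₂0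
  have hlog_le : ∀ x : ℝ, logPlus x ≤ 2 + |x| := fun x ↦ by
    rw [logPlus_eq]
    have h := Real.log_le_sub_one_of_pos (show (0 : ℝ) < 2 + |x| by positivity)
    linarith
  have hrow_le : ∀ k j : ℤ, |row (k, j)| ≤
      truncWeight T j * (C₄₄ * ((2 + |(k : ℝ)|) * (2 + |(j : ℝ)|))) := by
    intro k j
    by_cases hq : (k, j) ∈ nearbyPairs T
    · obtain ⟨hk, hj, hnb⟩ := (mem_nearbyPairs (p := (k, j))).1 hq
      simp only [hrow]
      rw [nearbyRow_eq_of_mem hq, abs_div, abs_of_nonneg (hψ0 j), div_eq_mul_one_div]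
      refine mul_le_mul_of_nonneg_left ?_ (hψ0 j)
      have h1 := h44 k j hk hj
      have hkj : (1 : ℝ) ≤ |(k : ℝ) - j| := by
        have : (1 : ℤ) ≤ |k - j| := Int.one_le_abs (sub_ne_zero.2 hnb.ne)
        have h' : ((1 : ℤ) : ℝ) ≤ ((|k - j| : ℤ) : ℝ) := by exact_mod_cast this
        simpa [Int.cast_abs, Int.cast_sub] using h'
      have hL : logPlus (|(k : ℝ)| + |(j : ℝ)|) ≤ (2 + |(k : ℝ)|) * (2 + |(j : ℝ)|) := by
        set a : ℝ := |(k : ℝ)| with ha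
        set b : ℝ := |(j : ℝ)| with hb
        have ha0 : 0 ≤ a := abs_nonneg _
        have hb0 : 0 ≤ b := abs_nonneg _
        have := hlog_le (a + b)
        rw [abs_of_nonneg (by positivity)] at this
        nlinarith [mul_nonneg ha0 hb0]
      calc 1 / |classicalLocationZ k - classicalLocationZ j|
          ≤ C₄₄ * (logPlus (|(k : ℝ)| + |(j : ℝ)|) / |(k : ℝ) - j|) := h1
        _ ≤ C₄₄ * (logPlus (|(k : ℝ)| + |(j : ℝ)|) / 1) :=
            mul_le_mul_of_nonneg_left
              (div_le_div_of_nonneg_left (logPlus_nonneg _) one_pos hkj) hC₄₄.le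
        _ ≤ C₄₄ * ((2 + |(k : ℝ)|) * (2 + |(j : ℝ)|)) := by
            rw [div_one]; exact mul_le_mul_of_nonneg_left hL hC₄₄.le
    · simp only [hrow]
      rw [nearbyRow_eq_zero hq, abs_zero]
      exact mul_nonneg (hψ0 j) (by positivity)
  have hGle : ∀ q : ℤ × ℤ, ‖G q‖ ≤ M₁ q.1 * M₂ q.2 := by
    rintro ⟨k, j⟩
    rw [Real.norm_eq_abs]
    by_cases hk : k = 0
    · -- `k = 0`: the row is empty
      have hnot : ((0 : ℤ), j) ∉ nearbyPairs T :=
        fun h ↦ ((mem_nearbyPairs (p := ((0 : ℤ), j))).1 h).1 rfl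
      have hz : G (k, j) = 0 := by
        simp only [hG, hrow, hk]
        rw [nearbyRow_eq_zero hnot, mul_zero]
      rw [hz, abs_zero]
      exact mul_nonneg (hM₁0 k) (hM₂0 j)
    · have h1 : |xiPVSum k| ≤ CP * (2 + |(k : ℝ)|) :=
        (hP k hk).trans (mul_le_mul_of_nonneg_left (hlog_le _) hCP.le)
      have h2 := hrow_le k j
      have hG' : |G (k, j)| = truncWeight T k * |xiPVSum k| * |row (k, j)| := by
        simp only [hG]
        rw [abs_mul, abs_mul, abs_of_nonneg (hψ0 k)]
      rw [hG']
      calc truncWeight T k * |xiPVSum k| * |row (k, j)|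
          ≤ truncWeight T k * (CP * (2 + |(k : ℝ)|)) *
              (truncWeight T j * (C₄₄ * ((2 + |(k : ℝ)|) * (2 + |(j : ℝ)|)))) :=
            mul_le_mul (mul_le_mul_of_nonneg_left h1 (hψ0 k)) h2 (abs_nonneg _)
              (mul_nonneg (hψ0 k) (by positivity))
        _ = M₁ k * M₂ j := by
            simp only [hM₁, hM₂, pow_one]; ring
  have hsG : Summable G := Summable.of_norm_bounded hmaj hGle
  -- (D) Fubini: `Σ_{ℤ×ℤ} G = Σ_k ψ_T(k) P_k S_k(T)`
  have hfib : ∀ k : ℤ, ∑' j, G (k, j) = truncWeight T k * xiPVSum k * ∑' j, row (k, j) := by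
    intro k
    simp only [hG]
    exact tsum_mul_left
  have hsum_eq : ∑' q, G q = ∑' k, truncWeight T k * xiPVSum k * ∑' j, row (k, j) := by
    rw [hsG.tsum_prod]
    exact tsum_congr hfib
  have hsK : Summable (fun k : ℤ ↦ truncWeight T k * xiPVSum k * ∑' j, row (k, j)) := by
    have := hsG.prod
    exact this.congr hfib
  -- (E) the bound via (souse)
  have hKle : ∀ k : ℤ, |truncWeight T k * xiPVSum k * ∑' j, row (k, j)| ≤
      CP / c₁ * (truncWeight T k * logPlus (classicalLocationZ k) * |∑' j, row (k, j)|) := by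
    intro k
    by_cases hk : k = 0
    · subst hk
      have hz : ∀ j : ℤ, row ((0 : ℤ), j) = 0 := fun j ↦ by
        have : ((0 : ℤ), j) ∉ nearbyPairs T :=
          fun h ↦ ((mem_nearbyPairs (p := ((0 : ℤ), j))).1 h).1 rfl
        simp only [hrow]
        exact nearbyRow_eq_zero this
      simp only [hz, tsum_zero, mul_zero, abs_zero]
      exact le_rfl
    · rw [abs_mul, abs_mul, abs_of_nonneg (hψ0 k)]
      have h1 : |xiPVSum k| ≤ CP / c₁ * logPlus (classicalLocationZ k) := by
        calc |xiPVSum k| ≤ CP * logPlus (k : ℝ) := hP k hk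
          _ ≤ CP * (logPlus (classicalLocationZ k) / c₁) :=
              mul_le_mul_of_nonneg_left (hlogξ k hk) hCP.le
          _ = CP / c₁ * logPlus (classicalLocationZ k) := by ring
      calc truncWeight T k * |xiPVSum k| * |∑' j, row (k, j)|
          ≤ truncWeight T k * (CP / c₁ * logPlus (classicalLocationZ k)) * |∑' j, row (k, j)| := by
            gcongr
            · exact hψ0 k
        _ = CP / c₁ * (truncWeight T k * logPlus (classicalLocationZ k) * |∑' j, row (k, j)|) := by
            ring
  have hbound : |∑' k, truncWeight T k * xiPVSum k * ∑' j, row (k, j)| ≤ ε * (T * Real.log T ^ 3) := by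
    have h1 : ‖∑' k, truncWeight T k * xiPVSum k * ∑' j, row (k, j)‖ ≤
        ∑' k, ‖truncWeight T k * xiPVSum k * ∑' j, row (k, j)‖ := norm_tsum_le_tsum_norm hsK.norm
    simp only [Real.norm_eq_abs] at h1
    have h2 : ∑' k, |truncWeight T k * xiPVSum k * ∑' j, row (k, j)| ≤
        ∑' k, CP / c₁ * (truncWeight T k * logPlus (classicalLocationZ k) * |∑' j, row (k, j)|) :=
      hsK.abs.tsum_le_tsum hKle (hsumS.mul_left _)
    rw [tsum_mul_left] at h2
    have h3 : CP / c₁ * ∑' k, truncWeight T k * logPlus (classicalLocationZ k) * |∑' j, row (k, j)| ≤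
        CP / c₁ * (ε * c₁ / CP * (T * Real.log T ^ 3)) :=
      mul_le_mul_of_nonneg_left hSle (by positivity)
    have h4 : CP / c₁ * (ε * c₁ / CP * (T * Real.log T ^ 3)) = ε * (T * Real.log T ^ 3) := by
      field_simp
    linarith
  -- (F) back to the nearby pairs
  have hsub : Summable (f ∘ (↑) : nearbyPairs T → ℝ) := by
    rw [summable_subtype_iff_indicator, hA]
    exact hsG
  refine ⟨hsub, ?_⟩
  change |∑' p : nearbyPairs T, f p| ≤ ε * (T * Real.log T ^ 3)
  rw [tsum_subtype (nearbyPairs T) f, hA, hsum_eq]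
  exact hbound


/-- The swap `(k, j) ↦ (j, k)` is a bijection of the nearby pairs (`∼_T` is symmetric).
[cite: RodgersTaoFMP2020, §1.2 p. 7 («This is clearly a symmetric relation»)] -/
theorem RodgersTaoXiPV.mem_nearbyPairs_swap {T : ℝ} {q : ℤ × ℤ} :
    q.swap ∈ nearbyPairs T ↔ q ∈ nearbyPairs T := by
  obtain ⟨k, j⟩ := q
  simp only [Prod.swap_prod_mk, mem_nearbyPairs]
  exact ⟨fun ⟨h1, h2, h3⟩ ↦ ⟨h2, h1, h3.symm⟩, fun ⟨h1, h2, h3⟩ ↦ ⟨h2, h1, h3.symm⟩⟩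

/-- **(sumjk-2) is negligible**, in the orientation `(j, k)` of (sumjk-2) as printed
(`Σ_{j,k : j ∼_T k} ψ_T(j)ψ_T(k) (1/(ξ_k − ξ_j)) Σ'_{i ≠ k} 1/(ξ_k − ξ_i)`, the principal value sum
attached to the SECOND index): for every `ε > 0` there is `T₁` such that for all `T ≥ T₁` the
family is summable over the nearby pairs and its sum is at most `ε · T log³ T` in absolute value.
[cite: RodgersTaoFMP2020, Prop. 22 pp. 50–51 (sumjk-2)] -/
theorem sumjk2_negligible' :
    ∀ ε : ℝ, 0 < ε → ∃ T₁ : ℝ, ∀ T : ℝ, T₁ ≤ T →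
      Summable (fun p : nearbyPairs T ↦ truncWeight T p.1.1 * truncWeight T p.1.2 /
        (classicalLocationZ p.1.2 - classicalLocationZ p.1.1) * xiPVSum p.1.2) ∧
      |∑' p : nearbyPairs T, truncWeight T p.1.1 * truncWeight T p.1.2 /
        (classicalLocationZ p.1.2 - classicalLocationZ p.1.1) * xiPVSum p.1.2| ≤
        ε * (T * Real.log T ^ 3) := by
  intro ε hε
  obtain ⟨T₁, h⟩ := sumjk2_negligible ε hε
  refine ⟨T₁, fun T hT ↦ ?_⟩
  obtain ⟨hs, hb⟩ := h T hT
  -- transport along the swap of the nearby pairs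
  set e : nearbyPairs T ≃ nearbyPairs T :=
    (Equiv.prodComm ℤ ℤ).subtypeEquiv fun q ↦ RodgersTaoXiPV.mem_nearbyPairs_swap.symm with he
  set g : nearbyPairs T → ℝ := fun p ↦ truncWeight T p.1.1 * truncWeight T p.1.2 /
        (classicalLocationZ p.1.1 - classicalLocationZ p.1.2) * xiPVSum p.1.1 with hg
  have hfun : (fun p : nearbyPairs T ↦ truncWeight T p.1.1 * truncWeight T p.1.2 /
        (classicalLocationZ p.1.2 - classicalLocationZ p.1.1) * xiPVSum p.1.2) = g ∘ e := by
    funext p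
    obtain ⟨⟨j, k⟩, hp⟩ := p
    simp only [hg, he, Function.comp_apply, Equiv.subtypeEquiv_apply, Equiv.prodComm_apply,
      Prod.swap_prod_mk]
    ring
  have h2 : tsum (g ∘ ⇑e) = ∑' b, g b := e.tsum_eq g
  rw [hfun, h2]
  exact ⟨(e.summable_iff).2 hs, hb⟩

end Literature.NumberTheory.LFunctions

end
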